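import Summits.QuantumFields.BalabanUV.Beta.EriceRemainderEnclosureHistoryAutonomyOrderMarkov
import Summits.QuantumFields.BalabanUV.Beta.EriceRemainderEnclosureHistoryAutonomyEndSharp

/-!
# EriceRemainderEnclosureHistoryAutonomyOrderEnd — (E48e) THE ENDs OF THE ORDER STATION: under node U2's binder list at the SHARP CLOSED constant
# (`InjectedRate`, `ScaleShiftRate`, `HistLipschitz` with rows `Σ_i Λ k i ≤ M`, `EventualLowerH b`, `M·γ ≤ 3√3·b` — (E37c)∕(E38d)'s list VERBATIM) the
# CONTINUUM RUNNING COUPLING `gstar` of one history family `β` is STRICTLY INCREASING IN ITS INFRARED VALUE AT EVERY PHYSICAL SCALE — two lattice families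
# pinned at `g_IR < g_IRt` have `gstar g m < gstar gt m` for all `m` ((E48a)) — and it obeys a MARKOV renormalization-group equation: there is ONE continuous
# `Φ_β ≥ b` on ]0,γ] with `1∕g⋆_{m+1}² = 1∕g⋆_m² + Φ_β(g⋆_{m+1})` for EVERY admissible family, `gstar g` being THE box solution of that Markov flow from `g_IR` ((E48b))

Cell `pub-balaban`, β-function sub-cell, BINDER row D4 «RemainderConst leaves for Bałaban's split» (`HOME/BINDER-OWNERS.md`; owner lineage `b2b-balaban-beta-an4`;
this file by co-owner #2 lineage `b2b-balaban-beta-d4-p2`, generation 45), β-FLOW TEAM duty (1), FREEZE (0) honoured (def-free; (E37a)'s `seqBox_gstar_of_tendsto` ∕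
`memFlow_gstar_of_injectedRate`, (E37c)'s `zerothMoment_betaInf_of_rows` ∕ `rowBound_nonneg`, node U2's `le_betaInf_of_eventualLower` ∕ `tendsto_invSq`, (E38d)'s
`eq_gstar_of_memFlow_rows_closed`, (E39)'s `exists_memFlow_zm`, (E48a)'s `lt_of_pin_lt_zs_closed` ∕ `ne_of_pin_ne`, (E48b)'s `continuousOn_effective` ∕ `memFlow_effective` ∕
`eq_family_of_memFlow_effective` BY NAME — the binder lists are (E38d)'s VERBATIM).  Imports (E48b) `…HistoryAutonomyOrderMarkov` (hence (E48a)) + (E38d)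
`…HistoryAutonomyEndSharp`.

HONEST FRAMING (page 1, verbatim and binding).  *"Discharging BetaPertH makes Bałaban's UV stability UNCONDITIONAL — a real constructive-QFT result; it is
NOT the continuum limit and NOT the Clay problem."*  THIS FILE DISCHARGES NOTHING OF THE KIND.  The hypotheses are node U2's ∕ NE4's NOT-IN-PRINT shapes
(`InjectedRate`, `ScaleShiftRate`, `HistLipschitz` + row budget, `EventualLowerH`; GAPS G-t4-U2-1∕-2) — displayed, never asserted of [I]'s (1.22); the smallness
`M·γ ≤ 3√3·b` is a hypothesis on those shapes, not a printed fact.  AS-PRINTED: Erice p. 249 records a Markov `β_n(g²)` (`BetaFlowAsPrinted`, DELTA D-11): §2 says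
that IF the binder list holds THEN the continuum running coupling obeys SOME Markov equation with a continuous effective β-function — not that this function
is Erice's `β(g²)` or Bałaban's.  Row D4 class UNCHANGED (critical-path width 0; instance 0∕1; D4 DISCHARGE NO DATE).  HONEST DEPENDENCY: continuum YM on T⁴ ⇐
BetaPertH ∧ nine spine estimates (0/9 proved); BetaPertH ⇐ (D1) ∧ (D4) ∧ CAP+tail; G-an2-4 gates asym, D1 and NE2/3/4.

WHAT IS PROVED ([folklore]; 0 `def`, 0 sorry).  §1 **`gstar_lt_gstar_of_pin_lt_rows_closed`**, `gstar_le_gstar_of_pin_le_rows_closed`, `gstar_ne_gstar_of_pin_ne_rows_closed`.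
§2 **`exists_markov_law_rows_closed`** (ONE continuous `Φ_β` with floor `b` and the bound `betaInf β (γ,…) + M·γ` on ]0,γ] such that every admissible family's
`gstar g` is THE box solution of the Markov flow of `Φ_β` from its pin).
-/

noncomputable section
open Filter Topology Finset Set

namespace Summit.QuantumFields.BalabanUV.Beta.EriceRemainderEnclosureHistoryAutonomyOrderEnd

open Literature.MathematicalPhysics.QuantumFieldTheory.Balaban1983to89
open Literature.MathematicalPhysics.QuantumFieldTheory.Balaban1983to89.FlowStep
open Literature.MathematicalPhysics.QuantumFieldTheory.Balaban1983to89.T4CouplingMatching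
open Literature.MathematicalPhysics.QuantumFieldTheory.Balaban1983to89.T4CauchySum (InjectedRate)
open Literature.MathematicalPhysics.QuantumFieldTheory.Balaban1983to89.T4ContinuumCoupling
open Literature.MathematicalPhysics.QuantumFieldTheory.Balaban1983to89.T4BetaStationary
open Literature.MathematicalPhysics.QuantumFieldTheory.Balaban1983to89.T4BetaFlowWellPosed (MemFlow)
open Summit.QuantumFields.BalabanUV.Beta.EriceRemainderEnclosureHistoryAutonomy
open Summit.QuantumFields.BalabanUV.Beta.EriceRemainderEnclosureHistoryAutonomyEnd
open Summit.QuantumFields.BalabanUV.Beta.EriceRemainderEnclosureHistoryAutonomyThreshold (memFlow_unique_zs_closed)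
open Summit.QuantumFields.BalabanUV.Beta.EriceRemainderEnclosureHistoryAutonomyEndSharp (eq_gstar_of_memFlow_rows_closed)
open Summit.QuantumFields.BalabanUV.Beta.EriceRemainderEnclosureHistoryAutonomyExistence (exists_memFlow_zm)
open Summit.QuantumFields.BalabanUV.Beta.EriceRemainderEnclosureHistoryAutonomyOrder
open Summit.QuantumFields.BalabanUV.Beta.EriceRemainderEnclosureHistoryAutonomyOrderMarkov

variable {β : HBeta} {γ c θs : ℝ} {Λ : ℕ → ℕ → ℝ} {M : ℝ}
variable {g gt : ℕ → ℕ → ℝ} {gIR gIRt C θ₁ Ct θt b : ℝ} {k₀ : ℕ}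

/-! ## §1 The continuum running coupling is strictly increasing in its infrared value at every physical scale -/

/-- **THE CONTINUUM RUNNING COUPLING IS STRICTLY INCREASING IN ITS INFRARED VALUE — AT THE SHARP, CLOSED CONSTANT.**  Two lattice families `g`, `gt` of runs of
ONE history family `β` (each with its own `InjectedRate` constants), pinned at `g K K = g_IR < g_IRt = gt K K`; `β` under `ScaleShiftRate`, `HistLipschitz Λ` with rows
`Σ_i Λ k i ≤ M`, `EventualLowerH b`, and `M·γ ≤ 3√3·b`.  Then `gstar g m < gstar gt m` at EVERY physical scale `m`: continuum trajectories never meet and never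
cross ((E48a) `lt_of_pin_lt_zs_closed` on (E37a)'s `memFlow_gstar_of_injectedRate`). [folklore] -/
theorem gstar_lt_gstar_of_pin_lt_rows_closed (hθ1 : θ₁ < 1) (hinj : InjectedRate C 0 θ₁ (fun K j => disc (g K) (g (K + 1)) j))
    (hbox : ∀ K i, i ≤ K → 0 < g K i ∧ g K i ≤ γ) (hrun : ∀ K, RGEqH K β (g K)) (hpin : ∀ K, g K K = gIR)
    (hθt1 : θt < 1) (hinjt : InjectedRate Ct 0 θt (fun K j => disc (gt K) (gt (K + 1)) j))
    (hboxt : ∀ K i, i ≤ K → 0 < gt K i ∧ gt K i ≤ γ) (hrunt : ∀ K, RGEqH K β (gt K)) (hpint : ∀ K, gt K K = gIRt)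
    (hss : ScaleShiftRate c θs γ β) (hL : HistLipschitz Λ γ β) (hΛ : ∀ k i, i ≤ k → 0 ≤ Λ k i)
    (hrow : ∀ k, ∑ i ∈ range (k + 1), Λ k i ≤ M) (hθs0 : 0 ≤ θs) (hθs1 : θs < 1) (hev : EventualLowerH b γ k₀ β)
    (hb : 0 < b) (hsmall : M * γ ≤ 3 * Real.sqrt 3 * b) (hlt : gIR < gIRt) (m : ℕ) : gstar g m < gstar gt m := by
  have hgIR : 0 < gIR := by rw [← hpin 0]; exact (hbox 0 0 le_rfl).1
  have hgIRtγ : gIRt ≤ γ := by rw [← hpint 0]; exact (hboxt 0 0 le_rfl).2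
  have hconv : ∀ m, Tendsto (invSq g m) atTop (𝓝 (astar g m)) := fun m => tendsto_invSq hθ1 hinj m
  have hconvt : ∀ m, Tendsto (invSq gt m) atTop (𝓝 (astar gt m)) := fun m => tendsto_invSq hθt1 hinjt m
  exact lt_of_pin_lt_zs_closed hb (zerothMoment_betaInf_of_rows hss hθs1 hL hΛ hrow) (rowBound_nonneg hΛ hrow)
    (fun u hu => le_betaInf_of_eventualLower hss hθs1 hev hu) hsmall hgIR hlt hgIRtγ (seqBox_gstar_of_tendsto hbox hconv)
    (seqBox_gstar_of_tendsto hboxt hconvt) (memFlow_gstar_of_injectedRate hθ1 hinj hbox hrun hpin hss hL hθs0 hθs1)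
    (memFlow_gstar_of_injectedRate hθt1 hinjt hboxt hrunt hpint hss hL hθs0 hθs1) m

/-- WEAK ORDER of the continuum running coupling in its infrared value: `g_IR ≤ g_IRt` ⟹ `gstar g m ≤ gstar gt m`. [folklore] -/
theorem gstar_le_gstar_of_pin_le_rows_closed (hθ1 : θ₁ < 1) (hinj : InjectedRate C 0 θ₁ (fun K j => disc (g K) (g (K + 1)) j))
    (hbox : ∀ K i, i ≤ K → 0 < g K i ∧ g K i ≤ γ) (hrun : ∀ K, RGEqH K β (g K)) (hpin : ∀ K, g K K = gIR)
    (hθt1 : θt < 1) (hinjt : InjectedRate Ct 0 θt (fun K j => disc (gt K) (gt (K + 1)) j))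
    (hboxt : ∀ K i, i ≤ K → 0 < gt K i ∧ gt K i ≤ γ) (hrunt : ∀ K, RGEqH K β (gt K)) (hpint : ∀ K, gt K K = gIRt)
    (hss : ScaleShiftRate c θs γ β) (hL : HistLipschitz Λ γ β) (hΛ : ∀ k i, i ≤ k → 0 ≤ Λ k i)
    (hrow : ∀ k, ∑ i ∈ range (k + 1), Λ k i ≤ M) (hθs0 : 0 ≤ θs) (hθs1 : θs < 1) (hev : EventualLowerH b γ k₀ β)
    (hb : 0 < b) (hsmall : M * γ ≤ 3 * Real.sqrt 3 * b) (hle : gIR ≤ gIRt) (m : ℕ) : gstar g m ≤ gstar gt m := by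
  have hgIR : 0 < gIR := by rw [← hpin 0]; exact (hbox 0 0 le_rfl).1
  have hgIRtγ : gIRt ≤ γ := by rw [← hpint 0]; exact (hboxt 0 0 le_rfl).2
  have hconv : ∀ m, Tendsto (invSq g m) atTop (𝓝 (astar g m)) := fun m => tendsto_invSq hθ1 hinj m
  have hconvt : ∀ m, Tendsto (invSq gt m) atTop (𝓝 (astar gt m)) := fun m => tendsto_invSq hθt1 hinjt m
  have hBM := zerothMoment_betaInf_of_rows hss hθs1 hL hΛ hrow
  have hM := rowBound_nonneg hΛ hrow
  exact le_of_pin_le hb hBM hM (fun u hu => le_betaInf_of_eventualLower hss hθs1 hev hu)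
    (fun _ hp0 hpγ _ _ hu hu' hfu hfu' => memFlow_unique_zs_closed hBM hM hp0 hpγ hb
      (fun u hu => le_betaInf_of_eventualLower hss hθs1 hev hu) hsmall hu hu' hfu hfu')
    hgIR hle hgIRtγ (seqBox_gstar_of_tendsto hbox hconv) (seqBox_gstar_of_tendsto hboxt hconvt)
    (memFlow_gstar_of_injectedRate hθ1 hinj hbox hrun hpin hss hL hθs0 hθs1)
    (memFlow_gstar_of_injectedRate hθt1 hinjt hboxt hrunt hpint hss hL hθs0 hθs1) m

/-- NO MEETING: families pinned at DIFFERENT infrared values have different continuum running couplings at EVERY physical scale. [folklore] -/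
theorem gstar_ne_gstar_of_pin_ne_rows_closed (hθ1 : θ₁ < 1) (hinj : InjectedRate C 0 θ₁ (fun K j => disc (g K) (g (K + 1)) j))
    (hbox : ∀ K i, i ≤ K → 0 < g K i ∧ g K i ≤ γ) (hrun : ∀ K, RGEqH K β (g K)) (hpin : ∀ K, g K K = gIR)
    (hθt1 : θt < 1) (hinjt : InjectedRate Ct 0 θt (fun K j => disc (gt K) (gt (K + 1)) j))
    (hboxt : ∀ K i, i ≤ K → 0 < gt K i ∧ gt K i ≤ γ) (hrunt : ∀ K, RGEqH K β (gt K)) (hpint : ∀ K, gt K K = gIRt)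
    (hss : ScaleShiftRate c θs γ β) (hL : HistLipschitz Λ γ β) (hΛ : ∀ k i, i ≤ k → 0 ≤ Λ k i)
    (hrow : ∀ k, ∑ i ∈ range (k + 1), Λ k i ≤ M) (hθs0 : 0 ≤ θs) (hθs1 : θs < 1) (hev : EventualLowerH b γ k₀ β)
    (hb : 0 < b) (hsmall : M * γ ≤ 3 * Real.sqrt 3 * b) (hne : gIR ≠ gIRt) (m : ℕ) : gstar g m ≠ gstar gt m := by
  rcases lt_or_gt_of_ne hne with hlt | hlt
  · exact (gstar_lt_gstar_of_pin_lt_rows_closed hθ1 hinj hbox hrun hpin hθt1 hinjt hboxt hrunt hpint hss hL hΛ hrow hθs0 hθs1 hev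
      hb hsmall hlt m).ne
  · exact (gstar_lt_gstar_of_pin_lt_rows_closed hθt1 hinjt hboxt hrunt hpint hθ1 hinj hbox hrun hpin hss hL hΛ hrow hθs0 hθs1 hev
      hb hsmall hlt m).ne'

/-! ## §2 The continuum running coupling obeys a Markov renormalization-group equation with a continuous effective β-function -/

/-- **THE MARKOV LAW OF THE CONTINUUM RUNNING COUPLING.**  `β` under `ScaleShiftRate`, `HistLipschitz Λ` with rows `Σ_i Λ k i ≤ M`, `EventualLowerH b`,
`M·γ ≤ 3√3·b`, `γ > 0`.  There is ONE function `Φ` on ]0,γ] — continuous, `b ≤ Φ ≤ betaInf β (γ,γ,…) + M·γ` — such that for EVERY lattice family `g` of runs of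
`β` in the box with `InjectedRate` and pin `g K K = g_IR`: the continuum running coupling obeys the MARKOV equation `1∕g⋆_{m+1}² = 1∕g⋆_m² + Φ(g⋆_{m+1})`
(`MemFlow (u ↦ Φ (u 0)) g_IR (gstar g)`) and is THE box solution of that equation from `g_IR`.  `Φ = betaInf β ∘ S` with `S a` the box solution of the
`betaInf β`-flow from `a` ((E48b)). [folklore] -/
theorem exists_markov_law_rows_closed (hss : ScaleShiftRate c θs γ β) (hL : HistLipschitz Λ γ β) (hΛ : ∀ k i, i ≤ k → 0 ≤ Λ k i)
    (hrow : ∀ k, ∑ i ∈ range (k + 1), Λ k i ≤ M) (hθs0 : 0 ≤ θs) (hθs1 : θs < 1) (hev : EventualLowerH b γ k₀ β)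
    (hb : 0 < b) (hγ : 0 < γ) (hsmall : M * γ ≤ 3 * Real.sqrt 3 * b) :
    ∃ Φ : ℝ → ℝ, ContinuousOn Φ (Ioc 0 γ) ∧
      (∀ a, 0 < a → a ≤ γ → b ≤ Φ a ∧ Φ a ≤ betaInf β (fun _ => γ) + M * γ) ∧
      ∀ (g : ℕ → ℕ → ℝ) (gIR C θ₁ : ℝ), θ₁ < 1 → InjectedRate C 0 θ₁ (fun K j => disc (g K) (g (K + 1)) j) →
        (∀ K i, i ≤ K → 0 < g K i ∧ g K i ≤ γ) → (∀ K, RGEqH K β (g K)) → (∀ K, g K K = gIR) →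
        MemFlow (fun u => Φ (u 0)) gIR (gstar g) ∧
          ∀ k : ℕ → ℝ, SeqBox γ k → MemFlow (fun u => Φ (u 0)) gIR k → k = gstar g := by
  have hBM := zerothMoment_betaInf_of_rows hss hθs1 hL hΛ hrow
  have hM := rowBound_nonneg hΛ hrow
  have hlo : ∀ u, SeqBox γ u → b ≤ betaInf β u := fun u hu => le_betaInf_of_eventualLower hss hθs1 hev hu
  have huniq : ∀ p, 0 < p → p ≤ γ → ∀ u u' : ℕ → ℝ, SeqBox γ u → SeqBox γ u' → MemFlow (betaInf β) p u →
      MemFlow (betaInf β) p u' → u = u' :=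
    fun _ hp0 hpγ _ _ hu hu' hfu hfu' => memFlow_unique_zs_closed hBM hM hp0 hpγ hb hlo hsmall hu hu' hfu hfu'
  have hex : ∀ p : ℝ, 0 < p → p ≤ γ → ∃ k : ℕ → ℝ, SeqBox γ k ∧ MemFlow (betaInf β) p k :=
    fun p hp0 hpγ => exists_memFlow_zm hBM hM hp0 hpγ hb hlo
  choose! S hSbox hSflow using hex
  have hS : ∀ p, 0 < p → p ≤ γ → SeqBox γ (S p) ∧ MemFlow (betaInf β) p (S p) :=
    fun p hp0 hpγ => ⟨hSbox p hp0 hpγ, hSflow p hp0 hpγ⟩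
  refine ⟨fun a => betaInf β (S a), continuousOn_effective hb hγ hBM hM hlo hS huniq,
    fun a ha0 haγ => ⟨floor_effective hlo hS ha0 haγ, effective_le_upper hBM hS ha0 haγ⟩, ?_⟩
  intro g gIR C θ₁ hθ1 hinj hbox hrun hpin
  have hgIR : 0 < gIR := by rw [← hpin 0]; exact (hbox 0 0 le_rfl).1
  have hgIRγ : gIR ≤ γ := by rw [← hpin 0]; exact (hbox 0 0 le_rfl).2
  have hconv : ∀ m, Tendsto (invSq g m) atTop (𝓝 (astar g m)) := fun m => tendsto_invSq hθ1 hinj m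
  have hgbox : SeqBox γ (gstar g) := seqBox_gstar_of_tendsto hbox hconv
  have hgflow : MemFlow (betaInf β) gIR (gstar g) := memFlow_gstar_of_injectedRate hθ1 hinj hbox hrun hpin hss hL hθs0 hθs1
  refine ⟨memFlow_effective hS huniq ⟨hgIR, hgIRγ⟩ hgbox hgflow, fun k hk hfk => ?_⟩
  rw [eq_family_of_memFlow_effective hS huniq ⟨hgIR, hgIRγ⟩ hk hfk]
  exact (huniq gIR hgIR hgIRγ _ _ (hS gIR hgIR hgIRγ).1 hgbox (hS gIR hgIR hgIRγ).2 hgflow)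

end Summit.QuantumFields.BalabanUV.Beta.EriceRemainderEnclosureHistoryAutonomyOrderEnd

end
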